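import Literature.MathematicalPhysics.QuantumFieldTheory.Balaban1983to89.B15Prop1LinearisedKernelLevelZero

/-!
# `Balaban1983to89.B15Prop1FlatCoerciveSplit` — [Balaban1984PropagatorsII] = «[B6]», Lemma 2.4 (2.128) p. 245, (2.153) p. 249; [Balaban1985Variational] = «[15]», (44)–(48) p. 285,
# (82)–(83) p. 290; [Balaban1985Averaging] = «[4]», (122)–(126) p. 36, Prop. 4 (134)–(135) pp. 37–39; [Balaban1985BackgroundPropagators] = «[B9]», (3.78)–(3.81) p. 406; [Balaban1989LargeFieldII]
# (1.7)–(1.9) p. 358: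
# THE FLAT COERCIVITY LETTER (P) OF THE (β)-SPLIT ⟸ A FLAT «LEMMA 2.4»-SHAPED LETTER WITH ITS AVERAGING TERM + A LETTER ON THE FLAT AVERAGES OF A KERNEL FIELD —
# and NON-VACUITY of the second letter at the flat base

Honest framing: statement-level skeleton of published theorems with citation tags; proofs where landed; nothing here is a claim about the
Yang–Mills mass gap.  Cell `pub-ymgap`, HUMAN RULING D-0062 (Track A), seat `pub-ymgap-dag-n12-c` g25 (lane owner N12 = [B15], strategy s1); count-neutral; N12 NOT discharged;
finite 𝕋⁴ at fixed ε; nothing continuum ∕ OS ∕ mass-gap ∕ Clay.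

WHY (lane memo `N12-UNIFORMITY-SPEC.md` §8).  The (β)-split `B15Prop1RealCoerciveFromNearFlatExpansion` (p710229) displays the FLAT COERCIVITY letter (P): for every real slice field `p` in
the kernel of the linearised constraint AT THE BACKGROUND `U₀`, `cP·Σ_b‖p_b‖² ≤ d²∕ds² A(exp(sp)·1)|₀`.  Print's flat inequality is [B6] Lemma 2.4 (2.128) — `(1∕12d²)L^{−d−1}‖B‖² ≤
L^{d−2}Σ_c|(Q₁B)(c)|² + Σ_p|(∂₁B)(p)|²` in the block tree gauge — which carries the FLAT LINEAR averages `Q₁B` on its right ((2.153): on `{QB = 0}` the term drops).  A field in the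
kernel at `U₀` is killed by the linearised NONLINEAR averages `Q_j(U₀)` ([15] (44)), not by `Q_j(1)`; the difference is the BACKGROUND DEPENDENCE OF THE LINEARISED AVERAGING — printed in
[4] Sect. D (124)–(126) p. 36 («The first term … is the main term in this linear form, and it resembles the definition of the averaging operation Q in [2]. The remaining terms … can be estimated by
O(L²α₀) and the terms can be estimated by O(1)L²α₀L|A|»; Prop. 4 (134)–(135) for the `j`-fold average) and restated in [B9] Sect. C p. 406 (3.79)–(3.81) («Q(exp iBV) = Q(V) + F₂(B), and
|F₂(B)B′| ≦ O(1) sup|B| Q″|B′|», «Q_j(U′U) = Q_j(U) + F_{2,j}(A)», «|F_{2,j}(A)A′| ≦ O(1)α₁Q″_j|A′| on Λ_j … with a constant O(1) depending on d and L only»); [15] Sect. C itself prints no such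
display (p. 287 l. 25–30: prose analyticity in `U₀` only) — lit-balaban ME #43, 2026-08-29.  THIS FILE splits (P) accordingly into two print-shaped letters: (P♭Q) a FLAT «Lemma 2.4»-shaped coercivity WITH the averaging term, on the WHOLE real slice
(no kernel condition; depends on the determining set and the slice only — inhabitable per instance from dag-n12-w3's flat (β)♭ `N12ForestSlice` by compactness, or from pv09's
`B6Lemma24Torus.lemma24_torus` quantitatively), and (L) a bound on the FLAT linearised averages `Q_j(1)p̂` of a `U₀`-kernel field — THE ROW'S FIRST MISSING ESTIMATE in NODE 00's `dIterL`
currency; and it certifies that (L) is NOT VACUOUS: at the flat base `U₀ = 1` it holds with constant `0` (the kernel there IS `{Q_j(1)p̂ = 0}`, by `B15Prop1LinearisedKernelLevelZero`).  AT THE RECORD (L) is to be produced from [4] (124)–(126) ∕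
[B9] (3.79)–(3.81) in the block axial gauge of the tower proxies (pointwise, `O(1)L²α₀`, d- and L-dependent constants, uniform in `j`) — NODE 00's `dIterL` one-step formula `dAvgL_apply` vs the
flat `dAvgL_one_apply_of_skew`; not in this file.

CONTENTS (theorems only; no `def`, no `instance`, no `sorry`).  §1 ★★ `flatCoercive_of_flatAveragedCoercive_of_flatAverageBound` ((P) ⟸ (P♭Q) + (L), `cP := c♭ − CL`).
§2 `iter_blockAvg_flat_eq_one` (`Ū^j(1) = 1`), `guardOn_one_blockAvg` (the flat configuration is on every per-tower guard), ★ `dIterL_one_apply_eq_zero_of_fderiv_sliceDatum_eq_zero_one` (at `U₀ = 1` a real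
kernel field has ALL flat linearised averages zero — FILE 3's §2 at the flat base), ★★ `flatAverageBound_one` ((L) holds at `U₀ = 1` with `CL = 0`: non-vacuity).
HONEST SCOPE: algebra and bookkeeping; (P♭Q) and (L) are DISPLAYED letters (not proved here except (L) at the flat base); nothing of Bałaban's asserted; count-neutral; N12 NOT discharged;
the YM mass gap (Clay) is NOT proved by any of this — R4 closes only the conditional finite-𝕋⁴ rung `BalabanLadder.UV`.
-/

noncomputable section

namespace Literature.MathematicalPhysics.QuantumFieldTheory.Balaban1983to89.B15Prop1FlatCoerciveSplit

open Set Metric Filter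
open scoped Topology BigOperators
open Literature.MathematicalPhysics.QuantumFieldTheory.Balaban1983to89.Node00 (SU coeField coeField_apply SmallBelow ConstrSet constrCard constrEnum dIterL)
open T4AdjointCovarianceUnitary (lieSU)
open B15AveragingHolomorphic (iterMh)
open B15SU2ChartHolomorphic (genE expMulC logCoordC)
open B15Prop1RightInverseFromLinearisedAveraging (hasDerivAt_coe_avgFamily_expMul_smul)
open B15Prop1LinearisedKernelLevelZero (velocity_eq_zero_of_fderiv_sliceDatum_eq_zero_of_guardOn)
open B15Prop1AnalyticExtClause (cplxVec)
open B15Prop1ChartCalculusSU2 (E3)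
open B15Prop1ChartSU2 (su2Chart)
open B16Sect1Backgrounds (expMul)
open ExpMeanLog (expMeanLogSU)
open BlockAveraging (blockAvg)
open T4CubeChartGnomonic (SU2)
open T4Continuum B15DeterminingSets GaugeField
open scoped Matrix.Norms.L2Operator

variable {P : Params}

/-! ## §1  (P) ⟸ (P♭Q) + (L) -/

/-- ★★ **THE FLAT COERCIVITY LETTER (P) FROM A FLAT «LEMMA 2.4»-SHAPED LETTER AND A BOUND ON THE FLAT AVERAGES OF KERNEL FIELDS.**  Objects: a determining set `𝔹` read below `k`, a
slice `S`, ANY predicate `Ker` on real slice fields (at the record: `p ↦ DΦ₀(0)⟨cplxVec p⟩ = 0`, the kernel of the linearised constraint at `U₀`).  LETTERS: (P♭Q) for EVERY real slice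
field, `c♭·Σ_b‖p_b‖² ≤ d²∕ds² A(exp(sp)·1)|₀ + Σ_i ‖(Q_{j_i}(1)p̂)(c_i)‖²` — the flat second variation plus the squared FLAT linearised averages (`dIterL j (↑1) p̂`, `p̂_b = Σ_a p_{b,a}E_a`)
at the constrained bonds ([B6] (2.128)'s shape); (L) for every real slice field with `Ker p`, `Σ_i ‖(Q_{j_i}(1)p̂)(c_i)‖² ≤ CL·Σ_b‖p_b‖²` (print: [4] (124)–(126), [B9] (3.79)–(3.81)).
CONCLUSION: (P) with `cP := c♭ − CL` on `Ker`.
[cite: Balaban1984PropagatorsII, Lemma 2.4 (2.128) p.245, (2.153) p.249; Balaban1985Variational, (44) p.285, (82)–(83) p.290; Balaban1985Averaging, (122)–(126) p.36, Prop. 4 (134)–(135) pp.37–39; Balaban1985BackgroundPropagators, (3.79)–(3.81) p.406; Balaban1989LargeFieldII, (1.8)–(1.9) p.358] -/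
theorem flatCoercive_of_flatAveragedCoercive_of_flatAverageBound (𝔹 : DetSet P) (k : ℕ) (S : Submodule ℂ (VecField P 0 (EuclideanSpace ℂ (Fin 3))))
    (Ker : VecField P 0 E3 → Prop) {cflat CL : ℝ}
    (hPQ : ∀ p : VecField P 0 E3, cplxVec p ∈ S →
      cflat * ∑ b : PBond P 0, ‖p b‖ ^ 2 ≤ deriv (deriv fun s : ℝ => wilsonAction4 (expMul su2Chart (s • p) (1 : GaugeField P 0 SU2))) 0 +
        ∑ i : Fin (constrCard 𝔹 k), ‖dIterL ((constrEnum 𝔹 k).symm i).1 (coeField (1 : GaugeField P 0 SU2))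
          (fun b => ∑ a : Fin 3, ((p b a : ℝ) : ℂ) • genE a) ((constrEnum 𝔹 k).symm i).2.1‖ ^ 2)
    (hL : ∀ p : VecField P 0 E3, cplxVec p ∈ S → Ker p →
      ∑ i : Fin (constrCard 𝔹 k), ‖dIterL ((constrEnum 𝔹 k).symm i).1 (coeField (1 : GaugeField P 0 SU2))
          (fun b => ∑ a : Fin 3, ((p b a : ℝ) : ℂ) • genE a) ((constrEnum 𝔹 k).symm i).2.1‖ ^ 2 ≤ CL * ∑ b : PBond P 0, ‖p b‖ ^ 2) :
    ∀ p : VecField P 0 E3, cplxVec p ∈ S → Ker p →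
      (cflat - CL) * ∑ b : PBond P 0, ‖p b‖ ^ 2 ≤ deriv (deriv fun s : ℝ => wilsonAction4 (expMul su2Chart (s • p) (1 : GaugeField P 0 SU2))) 0 := by
  intro p hp hker
  have h1 := hPQ p hp
  have h2 := hL p hp hker
  rw [sub_mul]
  linarith

/-- The same in the binder shape of the (β)-split's (P) row (`Ker p := DΦ₀(0)⟨cplxVec p, _⟩ = 0` for slice datum coordinates `Φ₀ : S → F`).
[cite: Balaban1984PropagatorsII, Lemma 2.4 (2.128) p.245; Balaban1985Variational, (82)–(83) p.290; Balaban1989LargeFieldII, (1.9) p.358] -/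
theorem flatCoercive_of_flatAveragedCoercive_of_flatAverageBound_sliceDatum (𝔹 : DetSet P) (k : ℕ) (S : Submodule ℂ (VecField P 0 (EuclideanSpace ℂ (Fin 3))))
    {F : Type*} [NormedAddCommGroup F] [NormedSpace ℂ F] (Φ₀ : S → F) {cflat CL : ℝ}
    (hPQ : ∀ p : VecField P 0 E3, cplxVec p ∈ S →
      cflat * ∑ b : PBond P 0, ‖p b‖ ^ 2 ≤ deriv (deriv fun s : ℝ => wilsonAction4 (expMul su2Chart (s • p) (1 : GaugeField P 0 SU2))) 0 +
        ∑ i : Fin (constrCard 𝔹 k), ‖dIterL ((constrEnum 𝔹 k).symm i).1 (coeField (1 : GaugeField P 0 SU2))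
          (fun b => ∑ a : Fin 3, ((p b a : ℝ) : ℂ) • genE a) ((constrEnum 𝔹 k).symm i).2.1‖ ^ 2)
    (hL : ∀ (p : VecField P 0 E3) (hp : cplxVec p ∈ S), fderiv ℂ Φ₀ 0 ⟨cplxVec p, hp⟩ = 0 →
      ∑ i : Fin (constrCard 𝔹 k), ‖dIterL ((constrEnum 𝔹 k).symm i).1 (coeField (1 : GaugeField P 0 SU2))
          (fun b => ∑ a : Fin 3, ((p b a : ℝ) : ℂ) • genE a) ((constrEnum 𝔹 k).symm i).2.1‖ ^ 2 ≤ CL * ∑ b : PBond P 0, ‖p b‖ ^ 2) :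
    ∀ (p : VecField P 0 E3) (hp : cplxVec p ∈ S), fderiv ℂ Φ₀ 0 ⟨cplxVec p, hp⟩ = 0 →
      (cflat - CL) * ∑ b : PBond P 0, ‖p b‖ ^ 2 ≤ deriv (deriv fun s : ℝ => wilsonAction4 (expMul su2Chart (s • p) (1 : GaugeField P 0 SU2))) 0 := by
  intro p hp hker
  have h1 := hPQ p hp
  have h2 := hL p hp hker
  rw [sub_mul]
  linarith

/-! ## §2  Non-vacuity of (L): at the flat base the kernel IS `{Q_j(1)p̂ = 0}` -/

/-- `Ū^j(1) = 1` for the tree's (0.4) block averaging (generic lattice). [cite: Balaban1987RG1, (0.4) p.253; Balaban1988Convergent, (2.11) p.256] -/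
theorem iter_blockAvg_flat_eq_one : ∀ j : ℕ, Averaging.iter (fun j => blockAvg (P := P) (j := j) expMeanLogSU) j (1 : GaugeField P 0 SU2) = 1
  | 0 => rfl
  | j + 1 => by
    show (blockAvg (P := P) (j := j) expMeanLogSU).avg (Averaging.iter (fun j => blockAvg (P := P) (j := j) expMeanLogSU) j 1) = 1
    rw [iter_blockAvg_flat_eq_one j]
    exact T3DescentFibreTower.avgFun_one _ T3DescentFibreTower.expMeanLogSU_E_one

/-- **THE FLAT CONFIGURATION IS ON EVERY PER-TOWER GUARD** (its iterated averages are `1`, whose loop variables sit at `1`). [cite: Balaban1987RG1, (0.4) p.253] -/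
theorem guardOn_one_blockAvg (𝔹 : DetSet P) (k : ℕ) :
    ∀ i : Fin (constrCard 𝔹 k), ∀ j', j' < (((constrEnum 𝔹 k).symm i).1 : ℕ) → ∀ c' : PBond P (j' + 1),
      c' ∈ B10Eq42TorusConstraint.bondsIn (j' + 1) (B14.Eq22Determines.blockIter (((constrEnum 𝔹 k).symm i).1 : ℕ) ⁻¹'
        ({((constrEnum 𝔹 k).symm i).2.1.src, ((constrEnum 𝔹 k).symm i).2.1.tgt} : Set (Site P ((constrEnum 𝔹 k).symm i).1))) →
        BlockAveraging.Small expMeanLogSU (Averaging.iter (fun j => blockAvg (P := P) (j := j) expMeanLogSU) j' (1 : GaugeField P 0 SU2)) c' := by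
  intro i j' _ c' _
  rw [iter_blockAvg_flat_eq_one]
  exact T3DescentFibreTower.small_one _ c'

/-- The flat configuration is on the global guard below every level. [cite: Balaban1987RG1, (0.4) p.253 (bookkeeping)] -/
theorem smallBelow_one_blockAvg (k : ℕ) : SmallBelow (fun j => blockAvg (P := P) (j := j) expMeanLogSU) k (1 : GaugeField P 0 SU2) := fun j _ c => by
  rw [iter_blockAvg_flat_eq_one]
  exact T3DescentFibreTower.small_one _ c

/-- ★ **AT THE FLAT BASE A REAL KERNEL FIELD HAS ALL FLAT LINEARISED AVERAGES ZERO**: with `U₀ = 1` on the fibre of `W`, slice datum coordinates `Φ₀` (pointwise, as everywhere in the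
lineage), and `DΦ₀(0)⟨cplxVec p⟩ = 0`, every `(Q_{j_i}(1)p̂)(c_i)` vanishes — `B15Prop1LinearisedKernelLevelZero.velocity_eq_zero_of_fderiv_sliceDatum_eq_zero_of_guardOn` at the flat base,
whose velocities are the flat linearised averages (NODE 00's `hasDerivAt_coe_avgFamily_expMul_smul`, `SmallBelow k 1`). [cite: Balaban1985Variational, (44),(47) p.285, (82)–(83) p.290; Balaban1988Convergent, (2.10)–(2.11) p.256] -/
theorem dIterL_one_apply_eq_zero_of_fderiv_sliceDatum_eq_zero_one (𝔹 : DetSet P) (k : ℕ) (hk : k ≤ P.m + P.K) (W : MSField P SU2)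
    (hW : AgreeOn 𝔹 (avgFamily (fun j => blockAvg (P := P) (j := j) expMeanLogSU) (1 : GaugeField P 0 SU2)) W)
    (S : Submodule ℂ (VecField P 0 (EuclideanSpace ℂ (Fin 3))))
    {Φ₀ : S → Fin (constrCard 𝔹 k) → EuclideanSpace ℂ (Fin 3)}
    (hΦ₀ : ∀ (X : S) i, Φ₀ X i = logCoordC (star ((W ((constrEnum 𝔹 k).symm i).1 ((constrEnum 𝔹 k).symm i).2.1 : SU2) : Matrix (Fin 2) (Fin 2) ℂ) *
      iterMh ((constrEnum 𝔹 k).symm i).1 (expMulC (X : VecField P 0 (EuclideanSpace ℂ (Fin 3))) (coeField (1 : GaugeField P 0 SU2))) ((constrEnum 𝔹 k).symm i).2.1))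
    {p : VecField P 0 E3} (hp : cplxVec p ∈ S) (hker : fderiv ℂ Φ₀ 0 ⟨cplxVec p, hp⟩ = 0) (i : Fin (constrCard 𝔹 k)) :
    dIterL ((constrEnum 𝔹 k).symm i).1 (coeField (1 : GaugeField P 0 SU2)) (fun b => ∑ a : Fin 3, ((p b a : ℝ) : ℂ) • genE a) ((constrEnum 𝔹 k).symm i).2.1 = 0 := by
  -- the flat velocity at the constrained bond `i` is the flat linearised average of `p̂ · 1 = p̂`
  have hv := hasDerivAt_coe_avgFamily_expMul_smul (U₀ := (1 : GaugeField P 0 SU2))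
    ((smallBelow_one_blockAvg (P := P) k).mono (Nat.lt_succ_iff.1 ((constrEnum 𝔹 k).symm i).1.2)) p ((constrEnum 𝔹 k).symm i).2.1
  have hfield : (fun b : PBond P 0 => (∑ a : Fin 3, ((p b a : ℝ) : ℂ) • genE a) * (((1 : GaugeField P 0 SU2) b : SU2) : Matrix (Fin 2) (Fin 2) ℂ)) =
      fun b => ∑ a : Fin 3, ((p b a : ℝ) : ℂ) • genE a := by
    funext b
    have h1 : (((1 : GaugeField P 0 SU2) b : SU2) : Matrix (Fin 2) (Fin 2) ℂ) = 1 := rfl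
    rw [h1, mul_one]
  rw [hfield] at hv
  exact velocity_eq_zero_of_fderiv_sliceDatum_eq_zero_of_guardOn 𝔹 k hk W (guardOn_one_blockAvg 𝔹 k) hW S hΦ₀ hp hker i hv

/-- ★★ **NON-VACUITY OF (L)**: at the flat base `U₀ = 1` the letter (L) holds with `CL = 0` — a real kernel field has no flat linearised averages at all.
[cite: Balaban1985Variational, (47) p.285 («for U₀ = 1 … the averaging operation is linear»), (82)–(83) p.290; Balaban1984PropagatorsII, (2.153) p.249] -/
theorem flatAverageBound_one (𝔹 : DetSet P) (k : ℕ) (hk : k ≤ P.m + P.K) (W : MSField P SU2)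
    (hW : AgreeOn 𝔹 (avgFamily (fun j => blockAvg (P := P) (j := j) expMeanLogSU) (1 : GaugeField P 0 SU2)) W)
    (S : Submodule ℂ (VecField P 0 (EuclideanSpace ℂ (Fin 3))))
    {Φ₀ : S → Fin (constrCard 𝔹 k) → EuclideanSpace ℂ (Fin 3)}
    (hΦ₀ : ∀ (X : S) i, Φ₀ X i = logCoordC (star ((W ((constrEnum 𝔹 k).symm i).1 ((constrEnum 𝔹 k).symm i).2.1 : SU2) : Matrix (Fin 2) (Fin 2) ℂ) *
      iterMh ((constrEnum 𝔹 k).symm i).1 (expMulC (X : VecField P 0 (EuclideanSpace ℂ (Fin 3))) (coeField (1 : GaugeField P 0 SU2))) ((constrEnum 𝔹 k).symm i).2.1)) :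
    ∀ (p : VecField P 0 E3) (hp : cplxVec p ∈ S), fderiv ℂ Φ₀ 0 ⟨cplxVec p, hp⟩ = 0 →
      ∑ i : Fin (constrCard 𝔹 k), ‖dIterL ((constrEnum 𝔹 k).symm i).1 (coeField (1 : GaugeField P 0 SU2))
          (fun b => ∑ a : Fin 3, ((p b a : ℝ) : ℂ) • genE a) ((constrEnum 𝔹 k).symm i).2.1‖ ^ 2 ≤ 0 * ∑ b : PBond P 0, ‖p b‖ ^ 2 := by
  intro p hp hker
  rw [zero_mul]
  refine le_of_eq (Finset.sum_eq_zero fun i _ => ?_)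
  rw [dIterL_one_apply_eq_zero_of_fderiv_sliceDatum_eq_zero_one 𝔹 k hk W hW S hΦ₀ hp hker i, norm_zero, zero_pow two_ne_zero]

end Literature.MathematicalPhysics.QuantumFieldTheory.Balaban1983to89.B15Prop1FlatCoerciveSplit

end
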